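/-
Copyright (c) 2026 the pub-hodgecm-mathlib formalisation cell (harness21).  Prover seat hodgecm-mathlib-K2E5-p17 (g8), Track B «K2-LIT»,
#184♮ = hLiu418 = `stmt-HodgeConjecture-24832`; socket #41 — THE TOP, edition 8 «KIND W AT THE WHITTAKER LEVEL»: edition 7 (P = {½} ★ p861474, KIND 1 ★ p861664, `hRKc` ★ p861715) with KIND W's Euler identity stated for
`whittakerDelta νN S (f s) h` (β-free) and transported to the Fourier coefficient inside by ★ Φ2 + ★ ed. 4a′
(author of record, LEAD F0P6-plan (g14) BATCH #46 (a) ∕ #49).  THEOREMS ONLY; NO `Lines` import.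
-/
import Summits.HodgeConjecture.HodgeConjecture.Theorems.K2LiuSiegelEisensteinConstantTermFiniteness        -- ★ ed. 4a′ (this seat) ⊇ ed. 4a ⊇ ed. 3b
import Summits.HodgeConjecture.HodgeConjecture.Theorems.K2LiuSiegelEisensteinKindZeroBigCellLetters         -- ★ p861499 `standardFamily_growth`
import Summits.HodgeConjecture.HodgeConjecture.Theorems.K2LiuSiegelEisensteinBigCellTermPackageCM          -- ★ p861474 `exists_bigCell_termPackage_cm` (P₈ = {½}, scalar b^S∕a^S)
import Summits.HodgeConjecture.HodgeConjecture.Theorems.K2LiuSiegelEisensteinRankOneTermPackageInstanceWeighted  -- ★ p861664 `exists_kindOne_packages_sixLetters` (KIND 1 by name)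
import Summits.HodgeConjecture.HodgeConjecture.Theorems.K2LiuFourierCoeffDeltaContinuous                 -- ★ p861715 `continuous_fourierCoeffDelta_eisenstein{Series,Family}Delta` (`hRKc` paid)
import Summits.HodgeConjecture.HodgeConjecture.Theorems.K2LiuSiegelEisensteinCoeffNondegenerateCurve      -- ★ Φ2 `fourierCoeffDelta_eisensteinFamilyDelta_eq_curve` (`E_S = (∫β)⁻¹·W_S`, `det S ≠ 0`)
import Summits.HodgeConjecture.HodgeConjecture.Theorems.K2LiuSiegelEisensteinMiddleTermPackageInstance    -- ★ p861839 `exists_middleTerm_package` (I4 instance, K2E4-p11)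
import Summits.HodgeConjecture.HodgeConjecture.Theorems.K2LiuSiegelEisensteinWhittakerTermPackageFixedCarrier  -- ★ p861446 `exists_whittaker_packages_fourierCoeff_fixedCarrier`
import Summits.HodgeConjecture.HodgeConjecture.Theorems.K2LiuSiegelEisensteinWhittakerMajorant              -- ★ p861512 `whittaker_majorant∕summedGrowth_of_weightedGrowth`
import HarnessLib

/-!
# Crux `HLiu418`, socket #41 — THE TOP, edition 10 «MIDDLE TERM BY NAME»: edition 8 with the middle package `(E₇ h7d h7c h7eq h7g)` CONSUMED BY NAME from ★ p861839
# `exists_middleTerm_package` (K2E4-p11's I4 instance over ★ (β0-4)′) — its visible analytic letters become the TOP's by-value binders until I1∕I2∕I3 discharge them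

Cell `hodgecm-mathlib`, crux item hLiu418 = `stmt-HodgeConjecture-24832` (helper lane until the typist's tie; count-neutral).

Over ★ edition 3b `siegelEisensteinContinuation_of_kinds_fixedCarrier` (carrier a binder: `νN` Haar on `N_Δ(𝔸)`, `β` a covering weight with `β ≤ 𝟙_K`, `K` compact, `0 < ∫β < ∞` — the
tie builds it as ★ edition 2 does), THIS EDITION discharges BY NAME: KIND 0's identity-cell growth `hfgr` (★ p861499 `standardFamily_growth`), O41.4's finiteness `hH` (★ ed. 4a′
`lintegral_tsum_enorm_mul_weight_ne_top`), the big-cell letters `E₈` (★ p861499 `exists_E₈` over ★ p861423 `exists_bigCell_termPackage`), the KIND-0 assembly (★ ed. 4a); KIND W's per-`S`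
packages (★ p861446 `exists_whittaker_packages_fourierCoeff_fixedCarrier`) and lattice letters (★ p861512).  WHAT REMAINS BY VALUE (the named surface of record): the pole set `P`;
KIND 0: the big-cell SCALAR NORMALISATION `(r, G, a)` with `(∏(s−p))·r = G` holomorphic, `r·a = 1` (★ O41.6 `a^S∕b^S` at the frame, ★ p861474) and the CONTINUATION `(E, hEd, hEeq)` of
`a(s)·M(s)f_s(h)` (rows G6-fin∕G6-arch), the rational Weyl presentation `(wq, hwq)` (★ O41.4's), the MIDDLE package `E₇` ((u-0c), un-normalised currency); KIND 1: the per-`S` packages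
`(Ec₁, h1off, hd₁, hc₁, hcoef₁)` ((u-1a), ★ p861061 at `X := H(𝔸)`) and the weighted growth `(w₁, h1g)` ((u-1b)); KIND W: the factor data `(WT, G_W, hWTd, hGWd)`, the weighted growth `hg`,
the Euler identity `hRK` with its continuity `hRKc` (rows G1–G4 + the G2 glue) and a summable weight `w`.
HEAD **`siegelEisensteinContinuation_assembled`** ⇒ socket #41's body BYTES VERBATIM.
Sources: [Tan1999, §1 Main Theorem; §4 Props. 4.1, 4.4, 4.8]; [MoeglinWaldspurger1995, II.1.7, IV.1.8–IV.1.11]; [KudlaRallis1994, §1–§2]; [Liu2021, Lem. B.10 (2), B.12].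
HONEST LABEL.  Count-neutral helper until tied; `HC_CM` is proved only modulo the 7 printed citations (2 remaining named inputs: hLiu418 = `stmt-HodgeConjecture-24832`,
h413 = `stmt-HodgeConjecture-24833`) until rung 0 closes.
-/

set_option autoImplicit false
set_option linter.dupNamespace false -- the mandated namespace repeats `HodgeConjecture.HodgeConjecture`

noncomputable section

open scoped Matrix Topology ENNReal NNReal BigOperators
open NumberField IsDedekindDomain MeasureTheory Filter
open Literature.NumberTheory.Automorphic Literature.NumberTheory.GaloisRepresentations
open Literature.NumberTheory.GelbartRogawski1991 Literature.NumberTheory.GelbartRogawski1991.GRConstruction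
open Literature.NumberTheory.K2Lit.SiegelDoubled Literature.MeasureTheory.Group
open Literature.NumberTheory.Automorphic.IdeleClassGroup

namespace Summit.HodgeConjecture.HodgeConjecture.Cruxes.HLiu418.K2LiuSiegelEisensteinContinuationTopTen

open K2LiuSiegelUnipotentFourierDefs K2LiuSiegelEisensteinContinuationTopKinds K2LiuSiegelEisensteinConstantTermPackage K2LiuSiegelEisensteinConstantTermFiniteness
open K2LiuSiegelEisensteinKindZeroBigCellLetters (standardFamily_growth)
open K2LiuSiegelEisensteinBigCellTermPackageCM (exists_bigCell_termPackage_cm)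
open K2LiuSiegelEisensteinRankOneTermPackageInstanceWeighted (exists_kindOne_packages_sixLetters)
open K2LiuFourierCoeffDeltaContinuous (continuous_fourierCoeffDelta_eisensteinSeriesDelta continuous_fourierCoeffDelta_eisensteinFamilyDelta)
open K2LiuSiegelEisensteinCoeffNondegenerateCurve (fourierCoeffDelta_eisensteinFamilyDelta_eq_curve)
open K2LiuSiegelEisensteinMiddleTermPackageInstance (exists_middleTerm_package)
open K2LiuGL2FlatSectionFiniteData (ofFinite_mem)
open NumberField.mixedEmbedding (mixedSpace)
open K2LiuSiegelEisensteinWhittakerTermPackageFixedCarrier (exists_whittaker_packages_fourierCoeff_fixedCarrier)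
open K2LiuSiegelEisensteinWhittakerMajorant (whittaker_majorant_of_weightedGrowth whittaker_summedGrowth_of_weightedGrowth)

open Classical in
/-- **SOCKET #41, MIDDLE TERM BY NAME (edition 10).**  Edition 8 with KIND 0's middle package obtained from ★ p861839 `exists_middleTerm_package`: the binders
`(E₇ h7d h7c h7eq h7g)` are REPLACED by that instance's visible letters (adelic Haar carriers `ν μ μinf`, level data `S₇ γl`, the finite-dimensional `K`-type package `W`
with its extension letters, the inner family `φ` with its transformation ∕ holomorphy ∕ growth letters, the Levi map `mx`, line representatives `γ₇`, an idele class domain `𝓕`,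
the identification `hMID` and continuity `hMIDc` of the un-normalised middle term); everything else as edition 8 (P = {½} ★ p861474, KIND 1 ★ p861664, `hRKc` ★ p861715,
KIND W β-free).  THEN socket #41's `∃ P Es, (A1) ∧ … ∧ (A5)`.
[cite: Tan1999, §1 Main Theorem; §4 Props. 4.1, 4.4, 4.8] [cite: MoeglinWaldspurger1995, II.1.7, IV.1.8–IV.1.11] [cite: KudlaRallis1994, §1–§2] [cite: Liu2021, Lem. B.10 (2), B.12] -/
theorem siegelEisensteinContinuation_ten
    (L : Type) [Field L] [NumberField L] [IsCMField L] {n : ℕ} (e : Fin 2 × Fin 1 ≃ Fin n)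
    (dV : Fin 2 → L) (hdV : ∀ i, IsCMField.complexConj L (dV i) = dV i) (hdV0 : ∀ i, dV i ≠ 0)
    (dW : Fin 1 → L) (hdW : ∀ i, IsCMField.complexConj L (dW i) = dW i) (hdW0 : ∀ i, dW i ≠ 0)
    (lam : IdeleClassGroup L →ₜ* Circle) (hlam : IsConjugateSymplectic L lam) (hw : HasWeight L lam 1)
    (𝒦 : IwasawaDatum L e dV hdV dW hdW) (h𝒦 : 𝒦.IsStd) (f : ℂ → HA L e dV hdV dW hdW → ℂ)
    (hstd : IsStandardSectionFamily 𝒦 (toHeckeCharacter L lam⁻¹) f) (hcont : ∀ s, Continuous (f s))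
    -- the carrier (built by the tie as in ★ edition 2: Haar + ★ (C0) + ★ covering weight)
    [MeasurableSpace (unipDelta L e dV hdV dW hdW)] [BorelSpace (unipDelta L e dV hdV dW hdW)]
    (νN : Measure (unipDelta L e dV hdV dW hdW)) [νN.IsHaarMeasure]
    (β : unipDelta L e dV hdV dW hdW → ℝ≥0∞) (hβ : IsCoveringWeight (unipDeltaRat L e dV hdV dW hdW) β)
    (hβ0 : ∫⁻ u, β u ∂νN ≠ 0) (hβtop : ∫⁻ u, β u ∂νN ≠ ∞)
    {K : Set (unipDelta L e dV hdV dW hdW)} (hK : IsCompact K) (hβK : ∀ u, β u ≤ K.indicator 1 u)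
    -- KIND 0: rational Weyl presentation; big cell = ★ p861474's continuation letters `(S, hS, hur, E, hEd, hEeq)`; middle package
    (wq : unipDeltaRat L e dV hdV dW hdW → ratH L e dV hdV dW hdW)
    (hwq : ∀ ν, ((wq ν : ratH L e dV hdV dW hdW) : HA L e dV hdV dW hdW) = weylDelta L e dV hdV dW hdW * ((ν : unipDelta L e dV hdV dW hdW) : HA L e dV hdV dW hdW))
    {S : Set (HeightOneSpectrum (𝓞 ↥(maximalRealSubfield L)))} (hS : S.Finite) (hur : ∀ v ∉ S, (quadraticHeckeCharCM L).IsUnramifiedAt v)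
    (E : ℂ → HA L e dV hdV dW hdW → ℂ) (hEd : ∀ x : HA L e dV hdV dW hdW, DifferentiableOn ℂ (fun s : ℂ => E s x) {s : ℂ | 0 < s.re})
    (hEeq : ∀ (s : ℂ) (x : HA L e dV hdV dW hdW), (n : ℝ) / 2 < s.re →
      E s x = (partialStandardL S (fun _ => {1}) (2 * s + 1) * partialStandardL S (fun v => {(quadraticHeckeCharCM L).valueAtUniformizer v}) (2 * s + 2)) /
          (partialStandardL S (fun _ => {1}) (2 * s) * partialStandardL S (fun v => {(quadraticHeckeCharCM L).valueAtUniformizer v}) (2 * s - 1)) *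
        intertwiningDelta L e dV hdV dW hdW νN (f s) x)
    -- KIND 0 middle term: ★ p861839 (K2E4-p11) I4 instance letters BY VALUE — adelic carriers, level data, the K-type package `W`, the inner family `φ`, Levi map `mx`,
    -- line representatives `γ₇`, an idele class domain, the identification `hMID` and continuity `hMIDc` of the un-normalised middle term
    [MeasurableSpace (AdeleRing (𝓞 L) L)] [BorelSpace (AdeleRing (𝓞 L) L)]
    (ν : Measure (ideleGroup L)) [ν.IsHaarMeasure] (μ : Measure (Fin 2 → AdeleRing (𝓞 L) L)) [μ.IsAddHaarMeasure]
    (μinf : Measure (mixedSpace L)ˣ) [μinf.IsHaarMeasure]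
    (S₇ : Finset (HeightOneSpectrum (𝓞 L))) (γl : ∀ v : HeightOneSpectrum (𝓞 L), ValuativeRel.ValueGroupWithZero (v.adicCompletion L))
    (hγ0 : ∀ v ∈ S₇, γl v ≠ 0) (hγ1 : ∀ v ∈ S₇, γl v < 1)
    (W : Submodule ℂ (↥(standardMaximalCompactGL 2 L) → ℂ)) [FiniteDimensional ℂ W]
    (hWstab : ∀ B ∈ W, ∀ k₀ : ↥(standardMaximalCompactGL 2 L), (fun k => B (k * k₀)) ∈ W)
    (hWlaw : ∀ B ∈ W, ∀ p k : ↥(standardMaximalCompactGL 2 L),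
    ((p : GL (Fin 2) (AdeleRing (𝓞 L) L)) : Matrix (Fin 2) (Fin 2) (AdeleRing (𝓞 L) L)) 1 0 = 0 → B (p * k) = B k)
    (hWlev : ∀ B ∈ W, ∀ (k : ↥(standardMaximalCompactGL 2 L)) (r : GL (Fin 2) (FiniteAdeleRing (𝓞 L) L)) (hr : r ∈ glFiniteIntegralLevel 2 L),
    (∀ v ∈ S₇, GLn.evalAt 2 L v r ∈ congruenceGL 2 (γl v)) →
      B ⟨(k : GL (Fin 2) (AdeleRing (𝓞 L) L)) * GLn.ofFinite 2 L r, (standardMaximalCompactGL 2 L).mul_mem k.2 (ofFinite_mem hr)⟩ = B k)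
    (hWcont : ∀ B ∈ W, Continuous B)
    (hWext : ∀ B ∈ W, ∃ bB : ℂ → GL (Fin 2) (AdeleRing (𝓞 L) L) → ℂ,
    (∀ s : ℂ, 0 < s.re → ∀ (d : Fin 2 → (AdeleRing (𝓞 L) L)ˣ) (g : GL (Fin 2) (AdeleRing (𝓞 L) L)),
      bB s (glDiagonal 2 (AdeleRing (𝓞 L) L) d * g) =
        ((IdeleClassGroup.ideleNorm L (d 0) : ℝ) : ℂ) ^ (s + 1 / 2) * ((IdeleClassGroup.ideleNorm L (d 1) : ℝ) : ℂ) ^ (-(s + 1 / 2)) * bB s g) ∧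
    (∀ s : ℂ, 0 < s.re → ∀ u g : GL (Fin 2) (AdeleRing (𝓞 L) L), (u : Matrix (Fin 2) (Fin 2) (AdeleRing (𝓞 L) L)) 1 0 = 0 →
      (u : Matrix (Fin 2) (Fin 2) (AdeleRing (𝓞 L) L)) 0 0 = 1 → (u : Matrix (Fin 2) (Fin 2) (AdeleRing (𝓞 L) L)) 1 1 = 1 → bB s (u * g) = bB s g) ∧
    (∀ s : ℂ, 0 < s.re → ∀ (k : GL (Fin 2) (AdeleRing (𝓞 L) L)) (hk : k ∈ standardMaximalCompactGL 2 L), bB s k = B ⟨k, hk⟩))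
    (φ : ℂ → HA L e dV hdV dW hdW → GL (Fin 2) (AdeleRing (𝓞 L) L) → ℂ)
    (hφT : ∀ (s : ℂ) (x : HA L e dV hdV dW hdW), 0 < s.re → ∀ (d : Fin 2 → (AdeleRing (𝓞 L) L)ˣ) (g : GL (Fin 2) (AdeleRing (𝓞 L) L)),
    φ s x (glDiagonal 2 (AdeleRing (𝓞 L) L) d * g) =
      ((IdeleClassGroup.ideleNorm L (d 0) : ℝ) : ℂ) ^ (s + 1 / 2) * ((IdeleClassGroup.ideleNorm L (d 1) : ℝ) : ℂ) ^ (-(s + 1 / 2)) * φ s x g)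
    (hφN : ∀ (s : ℂ) (x : HA L e dV hdV dW hdW), 0 < s.re → ∀ u g : GL (Fin 2) (AdeleRing (𝓞 L) L), (u : Matrix (Fin 2) (Fin 2) (AdeleRing (𝓞 L) L)) 1 0 = 0 →
    (u : Matrix (Fin 2) (Fin 2) (AdeleRing (𝓞 L) L)) 0 0 = 1 → (u : Matrix (Fin 2) (Fin 2) (AdeleRing (𝓞 L) L)) 1 1 = 1 → φ s x (u * g) = φ s x g)
    (hφW : ∀ (s : ℂ) (x : HA L e dV hdV dW hdW), 0 < s.re → (fun k : ↥(standardMaximalCompactGL 2 L) => φ s x k) ∈ W)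
    (hφhol : ∀ (x : HA L e dV hdV dW hdW) (k : ↥(standardMaximalCompactGL 2 L)), DifferentiableOn ℂ (fun s => φ s x k) {s : ℂ | 0 < s.re})
    (hφbd : ∀ z : ℂ, 0 < z.re → ∃ C A r : ℝ, 0 ≤ C ∧ 0 ≤ A ∧ 0 < r ∧ ∀ s : ℂ, dist s z < r →
    ∀ (x : HA L e dV hdV dW hdW) (k : ↥(standardMaximalCompactGL 2 L)), ‖φ s x k‖ ≤ C * adelicHeightGL (n + n) L (x : GL (Fin (n + n)) (AdeleRing (𝓞 L) L)) ^ A)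
    (mx : HA L e dV hdV dW hdW → GL (Fin 2) (AdeleRing (𝓞 L) L)) {C₀ A₀ : ℝ} (hC₀ : 0 ≤ C₀) (hA₀ : 0 ≤ A₀)
    (hmx : ∀ x : HA L e dV hdV dW hdW, adelicHeightGL 2 L (mx x) ≤ C₀ * adelicHeightGL (n + n) L (x : GL (Fin (n + n)) (AdeleRing (𝓞 L) L)) ^ A₀)
    (γ₇ : Projectivization L (Fin 2 → L) → GL (Fin 2) L)
    (hγ : ∀ p, ∃ cL : L, cL ≠ 0 ∧ (Pi.single 1 1 : Fin 2 → L) ᵥ* (γ₇ p : Matrix (Fin 2) (Fin 2) L) = cL • p.rep)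
    {𝓕 : Set (ideleGroup L)} (h𝓕 : IsIdeleClassDomain L 𝓕)
    (c₀ : ℂ)
    (hMID : ∀ (s : ℂ) (h : HA L e dV hdV dW hdW), (n : ℝ) / 2 < s.re →
      (∫ u, (β u).toReal •
        (∑' q : ↥(({Quotient.mk (MulAction.orbitRel (siegelDeltaRat L e dV hdV dW hdW) (ratH L e dV hdV dW hdW)) 1} ∪
            Set.range (fun ν : unipDeltaRat L e dV hdV dW hdW =>
              (Quotient.mk (MulAction.orbitRel (siegelDeltaRat L e dV hdV dW hdW) (ratH L e dV hdV dW hdW)) (wq ν) :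
                SiegelDeltaQuot L e dV hdV dW hdW)))ᶜ : Set (SiegelDeltaQuot L e dV hdV dW hdW)),
          f s ((((Quotient.out (q : SiegelDeltaQuot L e dV hdV dW hdW) : ratH L e dV hdV dW hdW) : HA L e dV hdV dW hdW)) *
            ((u : HA L e dV hdV dW hdW) * h))) ∂νN) =
        c₀ * ∑' p : Projectivization L (Fin 2 → L), φ s h (Matrix.GeneralLinearGroup.map (algebraMap L (AdeleRing (𝓞 L) L)) (γ₇ p) * mx h))
    (hMIDc : ∀ s : ℂ, (n : ℝ) / 2 < s.re → Continuous fun h : HA L e dV hdV dW hdW => ∫ u, (β u).toReal •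
        (∑' q : ↥(({Quotient.mk (MulAction.orbitRel (siegelDeltaRat L e dV hdV dW hdW) (ratH L e dV hdV dW hdW)) 1} ∪
            Set.range (fun ν : unipDeltaRat L e dV hdV dW hdW =>
              (Quotient.mk (MulAction.orbitRel (siegelDeltaRat L e dV hdV dW hdW) (ratH L e dV hdV dW hdW)) (wq ν) :
                SiegelDeltaQuot L e dV hdV dW hdW)))ᶜ : Set (SiegelDeltaQuot L e dV hdV dW hdW)),
          f s ((((Quotient.out (q : SiegelDeltaQuot L e dV hdV dW hdW) : ratH L e dV hdV dW hdW) : HA L e dV hdV dW hdW)) *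
            ((u : HA L e dV hdV dW hdW) * h))) ∂νN)
    -- KIND 1: ★ p861664's letters — term data, weights, weighted growth, decay, coefficient identity (`hRKc` is ★ p861715)
    (ι : skewMatrices ((IsCMField.complexConj L : L ≃ₐ[Fp L] L) : L →+* L) ((gramR L e dV hdV dW hdW).map (algebraMap (Fp L) L)) → Type) [∀ S, Fintype (ι S)]
    (a : ∀ S, ι S → ℂ → HA L e dV hdV dW hdW → ℂ)
    (had : ∀ S j x, DifferentiableOn ℂ (fun s => a S j s x) {s : ℂ | 0 < s.re})
    (ρb ρa G : skewMatrices ((IsCMField.complexConj L : L ≃ₐ[Fp L] L) : L →+* L) ((gramR L e dV hdV dW hdW).map (algebraMap (Fp L) L)) → ℂ → ℂ)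
    (hρb : ∀ S, DifferentiableOn ℂ (ρb S) {s : ℂ | 0 < s.re})
    (hG : ∀ S, DifferentiableOn ℂ (G S) {s : ℂ | 0 < s.re}) (hGρ : ∀ S, ∀ s : ℂ, 0 < s.re → s ≠ 1 / 2 → G S s = (s - 1 / 2) * ρa S s)
    (Eb Ea : ∀ S, ι S → ℂ → HA L e dV hdV dW hdW → ℂ)
    (hEb : ∀ S j x, DifferentiableOn ℂ (fun s => Eb S j s x) {s : ℂ | 0 < s.re})
    (hEa : ∀ S j x, DifferentiableOn ℂ (fun s => Ea S j s x) {s : ℂ | 0 < s.re})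
    (ua ub uG : skewMatrices ((IsCMField.complexConj L : L ≃ₐ[Fp L] L) : L →+* L) ((gramR L e dV hdV dW hdW).map (algebraMap (Fp L) L)) → ℝ)
    (hua : ∀ S, 0 ≤ ua S) (hub : ∀ S, 0 ≤ ub S) (huG : ∀ S, 0 ≤ uG S) (N₀ : ℕ) (hN₀ : ∀ S, Fintype.card (ι S) ≤ N₀)
    (hag : ∀ z : ℂ, 0 < z.re → ∃ C A r : ℝ, 0 ≤ C ∧ 0 ≤ A ∧ 0 < r ∧ ∀ S j (s : ℂ), dist s z < r → ∀ x : HA L e dV hdV dW hdW,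
      ‖a S j s x‖ ≤ C * ua S * adelicHeightGL (n + n) L (x : GL (Fin (n + n)) (AdeleRing (𝓞 L) L)) ^ A)
    (hbg : ∀ z : ℂ, 0 < z.re → ∃ C A r : ℝ, 0 ≤ C ∧ 0 ≤ A ∧ 0 < r ∧ ∀ S j (s : ℂ), dist s z < r → ∀ x : HA L e dV hdV dW hdW,
      ‖ρb S s * Eb S j s x‖ ≤ C * ub S * adelicHeightGL (n + n) L (x : GL (Fin (n + n)) (AdeleRing (𝓞 L) L)) ^ A)
    (haG : ∀ z : ℂ, 0 < z.re → ∃ C A r : ℝ, 0 ≤ C ∧ 0 ≤ A ∧ 0 < r ∧ ∀ S j (s : ℂ), dist s z < r → ∀ x : HA L e dV hdV dW hdW,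
      ‖G S s * Ea S j s x‖ ≤ C * uG S * adelicHeightGL (n + n) L (x : GL (Fin (n + n)) (AdeleRing (𝓞 L) L)) ^ A)
    (hws₁ : Summable fun S => ua S * (ub S + uG S))
    (hRK₁ : ∀ S : skewMatrices ((IsCMField.complexConj L : L ≃ₐ[Fp L] L) : L →+* L) ((gramR L e dV hdV dW hdW).map (algebraMap (Fp L) L)),
      (S : Matrix (Fin n) (Fin n) L) ≠ 0 → (S : Matrix (Fin n) (Fin n) L).det = 0 →
      ∀ (νN : Measure (unipDelta L e dV hdV dW hdW)) [νN.IsHaarMeasure] (β : unipDelta L e dV hdV dW hdW → ℝ≥0∞),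
      IsCoveringWeight (unipDeltaRat L e dV hdV dW hdW) β → ∫⁻ u, β u ∂νN ≠ 0 → ∫⁻ u, β u ∂νN ≠ ∞ →
      ∀ (s : ℂ) (h : HA L e dV hdV dW hdW), (n : ℝ) / 2 < s.re →
        fourierCoeffDelta L e dV hdV dW hdW νN β (S : Matrix (Fin n) (Fin n) L) (eisensteinFamilyDelta L e dV hdV dW hdW f s) h =
          ∑ j, a S j s h * (ρb S s * Eb S j s h + ρa S s * Ea S j s h))
    -- KIND W: factor data + weighted growth + the β-FREE Euler identity for the Whittaker functional (rows G1–G4 + glue; `hRKc` is ★ p861715, `E_S = (∫β)⁻¹·W_S` is ★ Φ2)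
    (WT GW : skewMatrices ((IsCMField.complexConj L : L ≃ₐ[Fp L] L) : L →+* L) ((gramR L e dV hdV dW hdW).map (algebraMap (Fp L) L)) → ℂ → HA L e dV hdV dW hdW → ℂ)
    (hWTd : ∀ S (h : HA L e dV hdV dW hdW), DifferentiableOn ℂ (fun s => WT S s h) {s : ℂ | 0 < s.re})
    (hGWd : ∀ S (h : HA L e dV hdV dW hdW), DifferentiableOn ℂ (fun s => GW S s h) {s : ℂ | 0 < s.re})
    (w : skewMatrices ((IsCMField.complexConj L : L ≃ₐ[Fp L] L) : L →+* L) ((gramR L e dV hdV dW hdW).map (algebraMap (Fp L) L)) → ℝ) (hw0 : ∀ S, 0 ≤ w S) (hws : Summable w)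
    (hg : ∀ z : ℂ, 0 < z.re → ∃ C A r : ℝ, 0 ≤ C ∧ 0 ≤ A ∧ 0 < r ∧ ∀ S (s : ℂ), dist s z < r → ∀ h : HA L e dV hdV dW hdW,
      ‖WT S s h * GW S s h‖ ≤ C * w S * adelicHeightGL (n + n) L (h : GL (Fin (n + n)) (AdeleRing (𝓞 L) L)) ^ A)
    (hRKW : ∀ S : skewMatrices ((IsCMField.complexConj L : L ≃ₐ[Fp L] L) : L →+* L) ((gramR L e dV hdV dW hdW).map (algebraMap (Fp L) L)),
      (S : Matrix (Fin n) (Fin n) L).det ≠ 0 → ∀ (s : ℂ) (h : HA L e dV hdV dW hdW), (n : ℝ) / 2 < s.re →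
        whittakerDelta L e dV hdV dW hdW νN (S : Matrix (Fin n) (Fin n) L) (f s) h = WT S s h * GW S s h) :
    ∃ (P : Finset ℂ) (Es : ℂ → HA L e dV hdV dW hdW → ℂ),
      (∀ h : HA L e dV hdV dW hdW, DifferentiableOn ℂ (fun s => Es s h) {s : ℂ | 0 < s.re}) ∧
      (∀ s : ℂ, 0 < s.re → Continuous (Es s)) ∧
      (∀ s : ℂ, 0 < s.re → ∀ (γ : ratH L e dV hdV dW hdW) (h : HA L e dV hdV dW hdW),
        Es s ((γ : HA L e dV hdV dW hdW) * h) = Es s h) ∧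
      (∀ (s : ℂ) (h : HA L e dV hdV dW hdW), (n : ℝ) / 2 < s.re →
        Es s h = (∏ p ∈ P, (s - p)) * eisensteinFamilyDelta L e dV hdV dW hdW f s h) ∧
      (∀ z : ℂ, 0 < z.re → ∃ C A r : ℝ, 0 < r ∧ ∀ s : ℂ, dist s z < r → ∀ h : HA L e dV hdV dW hdW,
        ‖Es s h‖ ≤ C * adelicHeightGL (n + n) L (h : GL (Fin (n + n)) (AdeleRing (𝓞 L) L)) ^ A) := by
  have hn : 0 < n := by
    have h2 : Fintype.card (Fin 2 × Fin 1) = Fintype.card (Fin n) := Fintype.card_congr e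
    simp only [Fintype.card_prod, Fintype.card_fin] at h2
    omega
  haveI : NeZero n := ⟨hn.ne'⟩
  have hχ : (toHeckeCharacter L lam⁻¹).IsUnitary := isUnitary_toHeckeCharacter L lam⁻¹
  -- KIND W at the Whittaker level: `E_S = (∫β)⁻¹·W_S` (★ Φ2 under ★ ed. 4a′), `WT` rescaled by `c := (∫β)⁻¹`; packages ★ p861446, lattice letters ★ p861512
  set c : ℝ := (∫⁻ u, β u ∂νN).toReal⁻¹ with hc
  have hWTd' : ∀ S (h : HA L e dV hdV dW hdW), DifferentiableOn ℂ (fun s => (c : ℂ) * WT S s h) {s : ℂ | 0 < s.re} :=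
    fun S h => (hWTd S h).const_mul _
  have hg' : ∀ z : ℂ, 0 < z.re → ∃ C A r : ℝ, 0 ≤ C ∧ 0 ≤ A ∧ 0 < r ∧ ∀ S (s : ℂ), dist s z < r → ∀ h : HA L e dV hdV dW hdW,
      ‖(c : ℂ) * WT S s h * GW S s h‖ ≤ C * w S * adelicHeightGL (n + n) L (h : GL (Fin (n + n)) (AdeleRing (𝓞 L) L)) ^ A := by
    intro z hz
    obtain ⟨C, A, r, hC, hA, hr, hb⟩ := hg z hz
    refine ⟨|c| * C, A, r, by positivity, hA, hr, fun S s hs h => ?_⟩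
    calc ‖(c : ℂ) * WT S s h * GW S s h‖ = |c| * ‖WT S s h * GW S s h‖ := by
          rw [mul_assoc, norm_mul, Complex.norm_real, Real.norm_eq_abs]
      _ ≤ |c| * (C * w S * adelicHeightGL (n + n) L (h : GL (Fin (n + n)) (AdeleRing (𝓞 L) L)) ^ A) :=
          mul_le_mul_of_nonneg_left (hb S s hs h) (abs_nonneg c)
      _ = |c| * C * w S * adelicHeightGL (n + n) L (h : GL (Fin (n + n)) (AdeleRing (𝓞 L) L)) ^ A := by ring
  have hRK : ∀ S : skewMatrices ((IsCMField.complexConj L : L ≃ₐ[Fp L] L) : L →+* L) ((gramR L e dV hdV dW hdW).map (algebraMap (Fp L) L)),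
      (S : Matrix (Fin n) (Fin n) L).det ≠ 0 → ∀ (s : ℂ) (h : HA L e dV hdV dW hdW), (n : ℝ) / 2 < s.re →
        fourierCoeffDelta L e dV hdV dW hdW νN β (S : Matrix (Fin n) (Fin n) L) (eisensteinFamilyDelta L e dV hdV dW hdW f s) h =
          (c : ℂ) * WT S s h * GW S s h := by
    intro S hdet s h hs
    rw [fourierCoeffDelta_eisensteinFamilyDelta_eq_curve e dV hdV hdV0 dW hdW hdW0 𝒦 hstd hcont wq hwq νN hβ s h
      (lintegral_tsum_enorm_mul_weight_ne_top L e dV hdV dW hdW hdV0 hdW0 hχ hs (hstd.1.1 s) (hcont s) νN hβtop hK hβK h) S.2 hdet,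
      hRKW S hdet s h hs, Complex.real_smul, hc, mul_assoc]
  obtain ⟨EcW, hWoff, hWd, hWc, hWcoef, hWg⟩ := exists_whittaker_packages_fourierCoeff_fixedCarrier L hn e dV hdV dW hdW νN β f
    (fun S s h => (c : ℂ) * WT S s h) GW hWTd' hGWd w hw0 hg'
    (fun S _ s hs => continuous_fourierCoeffDelta_eisensteinSeriesDelta L e dV hdV dW hdW hdV0 hdW0 νN hβ (S : Matrix (Fin n) (Fin n) L) hχ hs
      (hstd.1.1 s) (hcont s)) hRK ({(1 / 2 : ℂ)} : Finset ℂ)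
  -- KIND 1: ★ p861664 (packages + lattice letters by name), `hRKc` ★ p861715
  obtain ⟨Ec₁, h1off, hd₁, hc₁, hcoef₁, hmaj₁, hgr₁⟩ := exists_kindOne_packages_sixLetters L e dV hdV dW hdW hdV0 hdW0 hn f ({(1 / 2 : ℂ)} : Finset ℂ)
    (Finset.mem_singleton_self _) ι a had ρb ρa G hρb hG hGρ Eb Ea hEb hEa ua ub uG hua hub huG N₀ hN₀ hag hbg haG hws₁ hRK₁
    (fun S => continuous_fourierCoeffDelta_eisensteinFamilyDelta L e dV hdV dW hdW hdV0 hdW0 hχ hstd.1.1 hcont (S : Matrix (Fin n) (Fin n) L))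
  -- KIND 0: big cell (★ p861499 over ★ p861423), middle (rescaled), identity (★ `standardFamily_growth`), O41.4 finiteness (★ ed. 4a′), assembly (★ ed. 4a)
  have hn2 : n = 2 := by
    have h2 : Fintype.card (Fin 2 × Fin 1) = Fintype.card (Fin n) := Fintype.card_congr e
    simp only [Fintype.card_prod, Fintype.card_fin] at h2
    omega
  -- KIND 0 middle term: ★ p861839 (I4 instance)
  obtain ⟨E₇, h7d, h7c, h7eq, h7g⟩ := exists_middleTerm_package L e dV hdV dW hdW hn2 ν μ μinf S₇ γl hγ0 hγ1 W hWstab hWlaw hWlev hWcont hWext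
    φ hφT hφN hφW hφhol hφbd mx hC₀ hA₀ hmx γ₇ hγ νN β wq f h𝓕 c₀ hMID hMIDc
  obtain ⟨Ec₈, h8d, h8c, h8eq, h8g⟩ :=
    exists_bigCell_termPackage_cm L e dV hdV dW hdW hn2 hdV0 hdW0 𝒦 νN (toHeckeCharacter L lam⁻¹) hχ f hstd hcont hS hur E hEd hEeq
  obtain ⟨h8d', h8c', h8eq', h8g'⟩ := smul_package (fun h : HA L e dV hdV dW hdW => adelicHeightGL (n + n) L (h : GL (Fin (n + n)) (AdeleRing (𝓞 L) L)))
    ((∫⁻ u, β u ∂νN).toReal⁻¹) ({(1 / 2 : ℂ)} : Finset ℂ) _ Ec₈ h8d h8c h8eq h8g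
  obtain ⟨h7d', h7c', h7eq', h7g'⟩ := smul_package (fun h : HA L e dV hdV dW hdW => adelicHeightGL (n + n) L (h : GL (Fin (n + n)) (AdeleRing (𝓞 L) L)))
    ((∫⁻ u, β u ∂νN).toReal⁻¹) ({(1 / 2 : ℂ)} : Finset ℂ) _ E₇ h7d h7c h7eq h7g
  obtain ⟨Ec₀, hd₀, hc₀, hcoef₀, hbd₀, hgr₀⟩ := exists_constantTerm_package L e dV hdV dW hdW hn νN hβ hβ0 hβtop wq hwq f hstd.1.1 hcont
    (fun h => (hstd.1.2 h).differentiableOn) (standardFamily_growth L e dV hdV dW hdW 𝒦 hχ f hstd hcont)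
    (fun s h hs => lintegral_tsum_enorm_mul_weight_ne_top L e dV hdV dW hdW hdV0 hdW0 hχ hs (hstd.1.1 s) (hcont s) νN hβtop hK hβK h)
    ({(1 / 2 : ℂ)} : Finset ℂ) (fun s h => (∫⁻ u, β u ∂νN).toReal⁻¹ • Ec₈ s h) h8d' h8c' h8eq' h8g' (fun s h => (∫⁻ u, β u ∂νN).toReal⁻¹ • E₇ s h) h7d' h7c' h7eq' h7g'
  -- ★ edition 3b at `P := {½}`
  exact siegelEisensteinContinuation_of_kinds_fixedCarrier L e dV hdV hdV0 dW hdW hdW0 lam hlam hw 𝒦 h𝒦 f hstd hcont νN β hβ hβ0 hβtop ({(1 / 2 : ℂ)} : Finset ℂ)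
    Ec₀ hd₀ hc₀ hcoef₀ hbd₀ hgr₀ Ec₁ h1off hd₁ hc₁ (hcoef₁ νN β hβ hβ0 hβtop) hmaj₁ hgr₁
    EcW hWoff hWd hWc hWcoef
    (whittaker_majorant_of_weightedGrowth L hn e dV hdV dW hdW EcW w hw0 hws hWg) (whittaker_summedGrowth_of_weightedGrowth L e dV hdV dW hdW EcW w hws hWg)

end Summit.HodgeConjecture.HodgeConjecture.Cruxes.HLiu418.K2LiuSiegelEisensteinContinuationTopTen

end
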